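import Mathlib.MeasureTheory.Integral.Layercake
import Mathlib.Analysis.SpecialFunctions.ImproperIntegrals
import Mathlib.Analysis.SpecialFunctions.Pow.Integral
import HarnessLib

/-!
# First moments from a fractional moment and a polynomial tail

Topic `Literature/Probability/Moments`; namespace `Literature.Probability.Moments`.

`integral_le_of_fractionalMoment_of_tail`: on a finite measure space, for `Y ≥ 0` integrable,
`0 < σ < 1 < p`, a tail bound `μ{Y > t} ≤ B t^{-p}` (`t > 0`) and any threshold `T > 0`,
`∫ Y ≤ T^{1-σ} ∫ Y^σ + B·(p/(p-1))·T^{1-p}`.  The elementary layer-cake inequality behind the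
"fractional moments ⇒ moments" step of the fractional-moment method for random operators
(M. Aizenman, G. M. Graf, J. Phys. A 31 (1998) 6783, §2; M. Aizenman, S. Warzel, *Random
Operators*, AMS GSM 168 (2015), Ch. 7), isolated as a measure-theoretic lemma (no operators).
Also `rpow_le_one_add` (`y^σ ≤ 1 + y`) and the exponential form
`integral_le_exp_of_fractionalMoment_exp_of_tail` (`∫ Y^σ ≤ C e^{-x}` ⇒
`∫ Y ≤ (C + B p/(p-1)) e^{-((p-1)/(p-σ)) x}`).

Not here: the choice of `T` optimising the two terms, discrete (sum) versions, `p ≤ 1`.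
-/

noncomputable section

open MeasureTheory Set Real Filter

namespace Literature.Probability.Moments

/-- `y^σ ≤ 1 + y` for `y ≥ 0`, `0 ≤ σ ≤ 1` (so a fractional moment of an integrable non-negative
function on a finite measure space is integrable). [folklore] -/
theorem rpow_le_one_add {y σ : ℝ} (hy : 0 ≤ y) (hσ0 : 0 ≤ σ) (hσ1 : σ ≤ 1) : y ^ σ ≤ 1 + y := by
  rcases le_or_gt y 1 with h | h
  · have : y ^ σ ≤ 1 := Real.rpow_le_one hy h hσ0
    linarith
  · have : y ^ σ ≤ y ^ (1 : ℝ) := Real.rpow_le_rpow_of_exponent_le h.le hσ1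
    rw [Real.rpow_one] at this
    linarith

/-- **A fractional moment plus a polynomial tail of order `p > 1` control the first moment
(layer cake).**  For `Y ≥ 0` integrable on a finite measure space, `0 < σ < 1`, `1 < p` and
`μ{Y > t} ≤ B t^{-p}` for all `t > 0`: for every threshold `T > 0`,
`∫ Y dμ ≤ T^{1-σ} ∫ Y^σ dμ + B (p/(p-1)) T^{1-p}`.
Proof: split `Y = Y·1_{Y ≤ T} + Y·1_{Y > T}`, bound the first part pointwise by `T^{1-σ} Y^σ`,
and layer-cake the second (`∫ Y 1_{Y>T} = ∫₀^∞ μ{Y 1_{Y>T} > t} dt ≤ ∫₀^T B T^{-p} + ∫_T^∞ B t^{-p}`).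
This is the step by which fractional-moment bounds are upgraded to first/second-moment bounds
in the fractional-moment method once an a-priori tail (there: `|G(E+iη)| ≤ η⁻¹`, or a Wegner-type
estimate) is available (Aizenman–Graf 1998; Aizenman–Warzel, *Random Operators*, Ch. 7); with
`∫ Y^σ ≤ C e^{-δ n}` and `T = e^{γ n}`, `0 < γ < δ/(1-σ)`, both terms decay exponentially in `n`.
[folklore] -/
theorem integral_le_of_fractionalMoment_of_tail {Ω : Type*} [MeasurableSpace Ω] (μ : Measure Ω)
    [IsFiniteMeasure μ] {Y : Ω → ℝ} (hY0 : ∀ ω, 0 ≤ Y ω) (hYi : Integrable Y μ)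
    {σ p B T : ℝ} (hσ0 : 0 < σ) (hσ1 : σ < 1) (hp : 1 < p) (hT : 0 < T)
    (htail : ∀ t : ℝ, 0 < t → μ.real {ω | t < Y ω} ≤ B * t ^ (-p)) :
    ∫ ω, Y ω ∂μ ≤ T ^ (1 - σ) * ∫ ω, Y ω ^ σ ∂μ + B * (p / (p - 1)) * T ^ (1 - p) := by
  have hYm : AEStronglyMeasurable Y μ := hYi.aestronglyMeasurable
  -- the fractional moment is integrable
  have hYσ : Integrable (fun ω => Y ω ^ σ) μ := by
    refine Integrable.mono' ((integrable_const (1 : ℝ)).add hYi)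
      (hYm.aemeasurable.pow_const σ).aestronglyMeasurable (Eventually.of_forall fun ω => ?_)
    rw [Real.norm_eq_abs, abs_of_nonneg (Real.rpow_nonneg (hY0 ω) _)]
    exact rpow_le_one_add (hY0 ω) hσ0.le hσ1.le
  -- the split
  set g : Ω → ℝ := fun ω => if T < Y ω then Y ω else 0 with hg
  have hφ : Measurable fun y : ℝ => if T < y then y else 0 :=
    Measurable.ite measurableSet_Ioi measurable_id measurable_const
  have hgm : AEStronglyMeasurable g μ := (hφ.comp_aemeasurable hYm.aemeasurable).aestronglyMeasurable
  have hg0 : ∀ ω, 0 ≤ g ω := fun ω => by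
    simp only [hg]; split_ifs <;> [exact (hY0 ω); exact le_rfl]
  have hgle : ∀ ω, g ω ≤ Y ω := fun ω => by
    simp only [hg]; split_ifs <;> [exact le_rfl; exact hY0 ω]
  have hgi : Integrable g μ :=
    Integrable.mono' hYi hgm (Eventually.of_forall fun ω => by
      rw [Real.norm_eq_abs, abs_of_nonneg (hg0 ω)]; exact hgle ω)
  have hsplit : ∀ ω, Y ω = (Y ω - g ω) + g ω := fun ω => by ring
  have hf_le : ∀ ω, Y ω - g ω ≤ T ^ (1 - σ) * Y ω ^ σ := fun ω => by
    simp only [hg]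
    split_ifs with h
    · rw [sub_self]; exact mul_nonneg (Real.rpow_nonneg hT.le _) (Real.rpow_nonneg (hY0 ω) _)
    · replace h : Y ω ≤ T := not_lt.1 h
      rw [sub_zero]
      have h1 : Y ω = Y ω ^ (1 - σ) * Y ω ^ σ := by
        rw [← Real.rpow_add' (hY0 ω) (by norm_num : (1 - σ) + σ ≠ 0)]
        norm_num
      have h2 : Y ω ^ (1 - σ) ≤ T ^ (1 - σ) :=
        Real.rpow_le_rpow (hY0 ω) h (by linarith)
      calc Y ω = Y ω ^ (1 - σ) * Y ω ^ σ := h1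
        _ ≤ T ^ (1 - σ) * Y ω ^ σ :=
          mul_le_mul_of_nonneg_right h2 (Real.rpow_nonneg (hY0 ω) _)
  have hpart1 : ∫ ω, (Y ω - g ω) ∂μ ≤ T ^ (1 - σ) * ∫ ω, Y ω ^ σ ∂μ := by
    rw [← integral_const_mul]
    exact integral_mono (hYi.sub hgi) (hYσ.const_mul _) hf_le
  -- layer cake for `g`
  have hlc : ∫ ω, g ω ∂μ = ∫ t in Ioi 0, μ.real {ω | t < g ω} :=
    hgi.integral_eq_integral_meas_lt (Eventually.of_forall hg0)
  have hset : ∀ t : ℝ, 0 < t → {ω | t < g ω} = {ω | max t T < Y ω} := by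
    intro t ht
    ext ω
    simp only [mem_setOf_eq, hg]
    split_ifs with h
    · rw [max_lt_iff]; exact ⟨fun h' => ⟨h', h⟩, fun h' => h'.1⟩
    · replace h : Y ω ≤ T := not_lt.1 h
      constructor
      · intro h'; linarith
      · intro h'; exact absurd ((le_max_right t T).trans_lt h') (not_lt.2 h)
  set hfun : ℝ → ℝ := fun t => B * (max t T) ^ (-p) with hhfun
  have hbound : ∀ t ∈ Ioi (0 : ℝ), μ.real {ω | t < g ω} ≤ hfun t := by
    intro t ht
    rw [hset t ht]
    exact htail _ (hT.trans_le (le_max_right t T))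
  -- integrability of the dominating function on `Ioi 0 = Ioc 0 T ∪ Ioi T`
  have hcont : Continuous fun t : ℝ => B * (max t T) ^ (-p) := by
    refine continuous_const.mul ?_
    refine Continuous.rpow_const (continuous_id.max continuous_const) fun t => Or.inl ?_
    exact (hT.trans_le (le_max_right t T)).ne'
  have hint1 : IntegrableOn hfun (Ioc 0 T) volume :=
    (hcont.integrableOn_Icc (a := 0) (b := T)).mono_set Ioc_subset_Icc_self
  have hint2 : IntegrableOn hfun (Ioi T) volume := by
    have h : IntegrableOn (fun t : ℝ => B * t ^ (-p)) (Ioi T) volume :=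
      (integrableOn_Ioi_rpow_of_lt (by linarith : -p < -1) hT).const_mul B
    refine IntegrableOn.congr_fun h (fun t ht => ?_) measurableSet_Ioi
    simp only [hhfun, max_eq_left (le_of_lt (mem_Ioi.1 ht))]
  have hint : IntegrableOn hfun (Ioi 0) volume := by
    rw [← Ioc_union_Ioi_eq_Ioi hT.le]
    exact hint1.union hint2
  have hpart2a : ∫ t in Ioi 0, μ.real {ω | t < g ω} ≤ ∫ t in Ioi 0, hfun t := by
    refine integral_mono_of_nonneg (Eventually.of_forall fun t => measureReal_nonneg) hint ?_
    exact (ae_restrict_iff' measurableSet_Ioi).2 (Eventually.of_forall hbound)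
  -- evaluate the dominating integral
  have hval1 : ∫ t in Ioc 0 T, hfun t = B * T ^ (1 - p) := by
    have heq : EqOn hfun (fun _ => B * T ^ (-p)) (Ioc 0 T) := fun t ht => by
      simp only [hhfun, max_eq_right ht.2]
    rw [setIntegral_congr_fun measurableSet_Ioc heq, setIntegral_const, Real.volume_real_Ioc_of_le hT.le,
      sub_zero, smul_eq_mul]
    have : T * T ^ (-p) = T ^ (1 - p) := by
      rw [show (1 - p) = 1 + (-p) by ring, Real.rpow_add hT, Real.rpow_one]
    rw [← this]; ring
  have hval2 : ∫ t in Ioi T, hfun t = B * (T ^ (1 - p) / (p - 1)) := by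
    have heq : EqOn hfun (fun t => B * t ^ (-p)) (Ioi T) := fun t ht => by
      simp only [hhfun, max_eq_left (le_of_lt (mem_Ioi.1 ht))]
    rw [setIntegral_congr_fun measurableSet_Ioi heq, integral_const_mul,
      integral_Ioi_rpow_of_lt (by linarith : -p < -1) hT]
    congr 1
    rw [show (-p + 1) = 1 - p by ring]
    field_simp
    have : (1 - p) ≠ 0 := by linarith
    have : (p - 1) ≠ 0 := by linarith
    field_simp
    ring
  have hval : ∫ t in Ioi 0, hfun t = B * (p / (p - 1)) * T ^ (1 - p) := by
    rw [← Ioc_union_Ioi_eq_Ioi hT.le, setIntegral_union (Ioc_disjoint_Ioi le_rfl) measurableSet_Ioi hint1 hint2,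
      hval1, hval2]
    have : (p - 1) ≠ 0 := by linarith
    field_simp
    ring
  -- assemble
  calc ∫ ω, Y ω ∂μ = ∫ ω, ((Y ω - g ω) + g ω) ∂μ := by simp
    _ = ∫ ω, (Y ω - g ω) ∂μ + ∫ ω, g ω ∂μ := integral_add (hYi.sub hgi) hgi
    _ ≤ T ^ (1 - σ) * ∫ ω, Y ω ^ σ ∂μ + B * (p / (p - 1)) * T ^ (1 - p) := by
        rw [hlc]
        exact add_le_add hpart1 (hpart2a.trans_eq hval)


/-- **Exponential form**: if the fractional moment is exponentially small, `∫ Y^σ ≤ C e^{-x}`,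
and the tail is polynomial of order `p > 1`, then the first moment is exponentially small at the
reduced rate `(p-1)/(p-σ)`: `∫ Y ≤ (C + B p/(p-1)) e^{-((p-1)/(p-σ)) x}` (threshold
`T = e^{x/(p-σ)}` balancing the two layer-cake terms). [folklore] -/
theorem integral_le_exp_of_fractionalMoment_exp_of_tail {Ω : Type*} [MeasurableSpace Ω]
    (μ : Measure Ω) [IsFiniteMeasure μ] {Y : Ω → ℝ} (hY0 : ∀ ω, 0 ≤ Y ω) (hYi : Integrable Y μ)
    {σ p B C x : ℝ} (hσ0 : 0 < σ) (hσ1 : σ < 1) (hp : 1 < p)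
    (hfm : ∫ ω, Y ω ^ σ ∂μ ≤ C * Real.exp (-x))
    (htail : ∀ t : ℝ, 0 < t → μ.real {ω | t < Y ω} ≤ B * t ^ (-p)) :
    ∫ ω, Y ω ∂μ ≤ (C + B * (p / (p - 1))) * Real.exp (-((p - 1) / (p - σ) * x)) := by
  have hps : 0 < p - σ := by linarith
  set T : ℝ := Real.exp (x / (p - σ)) with hT
  have hTpos : 0 < T := Real.exp_pos _
  have h := integral_le_of_fractionalMoment_of_tail μ hY0 hYi hσ0 hσ1 hp hTpos htail
  have h1 : T ^ (1 - σ) * (C * Real.exp (-x)) = C * Real.exp (-((p - 1) / (p - σ) * x)) := by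
    rw [hT, ← Real.exp_mul, mul_left_comm, ← Real.exp_add]
    congr 2
    field_simp
    ring
  have h2 : T ^ (1 - p) = Real.exp (-((p - 1) / (p - σ) * x)) := by
    rw [hT, ← Real.exp_mul]
    congr 1
    field_simp
    ring
  have h3 : T ^ (1 - σ) * ∫ ω, Y ω ^ σ ∂μ ≤ T ^ (1 - σ) * (C * Real.exp (-x)) :=
    mul_le_mul_of_nonneg_left hfm (Real.rpow_nonneg hTpos.le _)
  calc ∫ ω, Y ω ∂μ ≤ T ^ (1 - σ) * ∫ ω, Y ω ^ σ ∂μ + B * (p / (p - 1)) * T ^ (1 - p) := h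
    _ ≤ T ^ (1 - σ) * (C * Real.exp (-x)) + B * (p / (p - 1)) * T ^ (1 - p) := by linarith
    _ = (C + B * (p / (p - 1))) * Real.exp (-((p - 1) / (p - σ) * x)) := by rw [h1, h2]; ring

end Literature.Probability.Moments

end
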